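import Literature.AnabelianGeometry.EtaleTheta.Discharge.Sec5DegenerateDatumKummer

/-!
# [EtTh] §5, Lemma 5.9 (iv): the universal closures of the schemata `EnvIsoBiTheta` and `FrdIsMonoThetaEnv` are refuted at the degenerate §5 datum (p. 332 / PDF p. 106)

Mochizuki, *The étale theta function and its Frobenioid-theoretic manifestations*, Publ. RIMS **45**
(2009) [cite: MochizukiEtTh2009, Lem 5.9 (iv) p.332 (PDF p.106)].  abc-iut cell, block F (fact-proving wave), seat
abc-iut-f-115 (floating on the unseated tranche 123); PROOF-ONLY companion (theorems only) of
`Discharge/Sec5DegenerateDatum.lean` / `Discharge/Sec5DegenerateDatumKummer.lean` (this seat: the degenerate §5 datum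
`Sec5Toy.datum` over the one-object base, `Sec5Toy.DY_eq_bot`, `Sec5Toy.invOut_ne_one`) and of abc-iut-L2-t4's
`FrobenioidMonoThetaEnv.lean`, whose named facts
* `ThetaFrobenioid.EnvIsoBiTheta h1 h3 hsec hcs h8 DK T ι` (FACT-LIST **F-0545**) — Lemma 5.9 (iv): "the natural inclusions
  … determine an isomorphism of topological groups `E^Π_N ⥲ Π^tp_Y[μ_N]` which is an isomorphism of mod `N` bi-theta
  environments …", typed over the §5 datum, the free Kummer part `DK`, the §2 datum `T` and the identification `ι`;
* `ThetaFrobenioid.FrdIsMonoThetaEnv h1 h3 hsec hcs h8 DK T` (FACT-LIST **F-0546**) — Lemma 5.9 (iv) "In particular,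
  omitting the homomorphism `s^⊓-Π_N` yields a mod `N` mono-theta environment", typed as abc-iut-L2-t2's
  `ThetaEnvData.IsMonoThetaEnv (frdMonoThetaEnv … DK)`;
are SCHEMATA (FACT-LIST R5).

PROVED here:
* `Sec5Toy.exists_topOut_ne_one` — `Out(E^Π_N)` of the degenerate datum is non-trivial (the class of inversion);
* `Sec5Toy.not_frdIsMonoThetaEnv_datum_of_DY_eq_bot`, **`Sec5Toy.not_frdIsMonoThetaEnv_datum`**, **`Sec5Toy.not_forall_frdIsMonoThetaEnv`** (F-0546) — at `DK := Set.univ` the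
  subgroup `D = ⟨galOut ∪ constOut ∪ DK⟩ ⊆ Out(E^Π_N)` contains a non-trivial class, whereas the model's `D_Y` is TRIVIAL
  for the degenerate §2 datum; an isomorphism of mono-theta environments would transport `D` onto `D_Y` injectively —
  so `frdMonoThetaEnv … univ` is NOT a mono-theta environment there, and the universal closure over (§5 data at the
  one-object base, the §5 inputs, `DK`, §2 data) is FALSE;
* **`Sec5Toy.not_envIsoBiTheta_datum_univ`** (every `ι`, `DK := univ`, via abc-iut-L2-t4's `frdIsMonoThetaEnv_of`),
  **`Sec5Toy.not_envIsoBiTheta_datum_swap`** (every `DK`, `ι := swap`: already the first clause "`ι(Π^tp_Y̲) = Π^tp_Y`"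
  fails), **`Sec5Toy.not_forall_envIsoBiTheta`** (F-0545) — the universal closure is FALSE, in each free parameter
  separately.
Instance forms of record (unchanged, all conditional on the printed §5 inputs and the §5 ↔ §2 dictionary): abc-iut-L2-t11's
`envIsoBiTheta_of` / `frdIsMonoThetaEnv_of'` (Sec5BiThetaIso), `envIsoBiTheta_birat` / `frdIsMonoThetaEnv_birat`
(`DK := kummerOut`, Sec5KummerOutTransport), `envIsoBiTheta_canonical` / `frdIsMonoThetaEnv_canonical` (canonical `DK₀`,
Sec5BiThetaIsoCanonical), and their `_of_continuous` / `_of_galoisDictionary` / `_of_geometric` descendants.  FACT-LIST R5: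
named instances only.
HONEST FRAMING: counterexamples to ∀-closures of typed PREDICATES with free parameters, at a degenerate datum that is NOT the
tempered Frobenioid of a curve; nothing of [EtTh] is refuted or asserted; no FACT-LIST row is thereby proved; typed ≠ proved;
nothing here bears on [IUTchIII] Cor. 3.12 and no side is taken on any disputed claim.
-/

noncomputable section

namespace Literature.AnabelianGeometry.EtaleTheta

open CategoryTheory Literature.AlgebraicGeometry.Frobenioids

namespace Sec5Toy

/-- **`Out(E^Π_N)` is non-trivial at the degenerate datum**: the class of the (bi-continuous, non-inner) inversion
automorphism of the abelian topological group `E^Π_N`.  [cite: MochizukiEtTh2009, Lem 5.9 (iv) p.332 (PDF p.106)] -/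
theorem exists_topOut_ne_one : ∃ d : TopOut datum.EPiN, d ≠ 1 := by
  let φ₀ : MulAut datum.EPiN :=
    { toFun := fun x => x⁻¹
      invFun := fun x => x⁻¹
      left_inv := fun x => inv_inv x
      right_inv := fun x => inv_inv x
      map_mul' := fun x y => (mul_inv_rev x y).trans (epin_comm _ _) }
  have hφ₀ : φ₀ ∈ contMulAut datum.EPiN := ⟨continuous_inv_EPiN, continuous_inv_EPiN⟩
  exact ⟨TopOut.mk _ ⟨φ₀, hφ₀⟩, invOut_ne_one ⟨φ₀, hφ₀⟩ fun _ => rfl⟩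

/-! ### F-0546: `frdMonoThetaEnv … univ` is not a mono-theta environment at the degenerate datum -/

/-- **F-0546, the mechanism**: for ANY §2 datum `T` at level `N = 1` whose `D_Y` is trivial, abc-iut-L2-t4's
Frobenioid-theoretic mono-theta environment data on `E^Π_N` of the degenerate datum with full Kummer part
`DK := Set.univ` is NOT a mod `N` mono-theta environment for `T`: its `D ⊇ DK = Out(E^Π_N)` is non-trivial and an
isomorphism of mono-theta environments transports `D` onto `D_Y` injectively.
[cite: MochizukiEtTh2009, Lem 5.9 (iv) p.332 (PDF p.106)] -/
theorem not_frdIsMonoThetaEnv_datum_of_DY_eq_bot (T : ThetaEnvData.{0} datum.N) (hDY : T.DY = ⊥) :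
    ¬ datum.FrdIsMonoThetaEnv facts_datum.sectionsFactor datum.outerActionLZ_of facts_datum.sgpCapSection
        facts_datum.sgpCupSection facts_datum.constantsEqNormalizer Set.univ T := by
  rintro ⟨η, hη, ⟨i⟩⟩
  obtain ⟨d, hd⟩ := exists_topOut_ne_one
  have hmem : d ∈ (datum.frdMonoThetaEnv facts_datum.sectionsFactor datum.outerActionLZ_of
      facts_datum.sgpCapSection facts_datum.sgpCupSection facts_datum.constantsEqNormalizer Set.univ).D :=
    Subgroup.subset_closure (Or.inr (Set.mem_univ d))
  have h2 : TopOut.transport i.e d ∈ (T.modelMono hη).D := by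
    rw [← i.map_D]
    exact Subgroup.mem_map_of_mem _ hmem
  change TopOut.transport i.e d ∈ T.DY at h2
  rw [hDY, Subgroup.mem_bot] at h2
  have hback := ThetaFrobenioid.transport_transport_symm_apply i.e.symm d
  rw [ContinuousMulEquiv.symm_symm, h2, map_one] at hback
  exact hd hback.symm

/-- **F-0546 at the degenerate datum**: with the full Kummer part `DK := Set.univ`, the Frobenioid-theoretic mono-theta
environment data on `E^Π_N` is NOT a mod `N` mono-theta environment for the degenerate §2 datum (`D_Y = 1` there,
`DY_eq_bot`).  [cite: MochizukiEtTh2009, Lem 5.9 (iv) p.332 (PDF p.106)] -/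
theorem not_frdIsMonoThetaEnv_datum :
    ¬ datum.FrdIsMonoThetaEnv facts_datum.sectionsFactor datum.outerActionLZ_of facts_datum.sgpCapSection
        facts_datum.sgpCupSection facts_datum.constantsEqNormalizer Set.univ thetaEnvData :=
  not_frdIsMonoThetaEnv_datum_of_DY_eq_bot thetaEnvData DY_eq_bot

/-- **F-0546: the universal closure of the schema `FrdIsMonoThetaEnv` is FALSE** (already over §5 data at the one-object
base category): the Kummer part `DK` is a free parameter.  Instance forms of record (`frdIsMonoThetaEnv_of'`,
`frdIsMonoThetaEnv_birat`, `frdIsMonoThetaEnv_canonical`, …) are conditional on the printed §5 inputs and the §5 ↔ §2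
dictionary and are unchanged.  FACT-LIST R5: named instances only.  [cite: MochizukiEtTh2009, Lem 5.9 (iv) p.332 (PDF p.106)] -/
theorem not_forall_frdIsMonoThetaEnv :
    ¬ ∀ (𝔉 : ThetaFrobenioid.{0} (Discrete PUnit.{1}) (Discrete PUnit.{1})) (h1 : 𝔉.SectionsFactor)
        (h3 : 𝔉.OuterActionLZ) (hsec : 𝔉.SgpCapSection) (hcs : 𝔉.SgpCupSection) (h8 : 𝔉.ConstantsEqNormalizer)
        (DK : Set (TopOut 𝔉.EPiN)) (T : ThetaEnvData.{0} 𝔉.N), 𝔉.FrdIsMonoThetaEnv h1 h3 hsec hcs h8 DK T :=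
  fun h => not_frdIsMonoThetaEnv_datum (h datum _ _ _ _ _ Set.univ thetaEnvData)

/-! ### F-0545: `EnvIsoBiTheta` fails at the degenerate datum, in each free parameter -/

/-- **F-0545 at the degenerate datum, free `DK`**: with `DK := Set.univ`, for EVERY identification `ι`, the typed
Lemma 5.9 (iv) statement fails — it would make `frdMonoThetaEnv … univ` a mono-theta environment (abc-iut-L2-t4's
`frdIsMonoThetaEnv_of`).  [cite: MochizukiEtTh2009, Lem 5.9 (iv) p.332 (PDF p.106)] -/
theorem not_envIsoBiTheta_datum_univ (ι : datum.PiX ≃ₜ* thetaEnvData.PiX) :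
    ¬ datum.EnvIsoBiTheta facts_datum.sectionsFactor datum.outerActionLZ_of facts_datum.sgpCapSection
        facts_datum.sgpCupSection facts_datum.constantsEqNormalizer Set.univ thetaEnvData ι :=
  fun h => not_frdIsMonoThetaEnv_datum (datum.frdIsMonoThetaEnv_of _ _ _ _ _ _ _ _ h)

/-- **F-0545 at the degenerate datum, free `ι`**: with `ι := swap` (the swap of the first two factors of
`Π^tp_X̲ = ℤ × ℤ × ℤ`), for EVERY `DK`, already the first clause "`ι(Π^tp_Y̲) = Π^tp_Y`" of the typed Lemma 5.9 (iv)
statement fails (`(0,1,0) ∈ Π^tp_Y̲` goes to `(1,0,0) ∉ Π^tp_Y`).  [cite: MochizukiEtTh2009, Lem 5.9 (iv) p.332 (PDF p.106)] -/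
theorem not_envIsoBiTheta_datum_swap (DK : Set (TopOut datum.EPiN)) :
    ¬ datum.EnvIsoBiTheta facts_datum.sectionsFactor datum.outerActionLZ_of facts_datum.sgpCapSection
        facts_datum.sgpCupSection facts_datum.constantsEqNormalizer DK thetaEnvData swapTop := by
  intro h
  have hy : (y₀ : datum.PiX) ∈ datum.PiY := by
    rw [datum_PiY]
    exact y₀_mem.1
  exact swap_y₀_not_mem (h.1.le (Subgroup.mem_map_of_mem _ hy))

/-- **F-0545: the universal closure of the schema `EnvIsoBiTheta` is FALSE** (already over §5 data at the one-object base
category): both the Kummer part `DK` and the identification `ι` are free parameters.  Instance forms of record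
(`envIsoBiTheta_of`, `envIsoBiTheta_birat`, `envIsoBiTheta_canonical`, …) are conditional on the printed §5 inputs and
the §5 ↔ §2 dictionary and are unchanged.  FACT-LIST R5: named instances only.
[cite: MochizukiEtTh2009, Lem 5.9 (iv) p.332 (PDF p.106)] -/
theorem not_forall_envIsoBiTheta :
    ¬ ∀ (𝔉 : ThetaFrobenioid.{0} (Discrete PUnit.{1}) (Discrete PUnit.{1})) (h1 : 𝔉.SectionsFactor)
        (h3 : 𝔉.OuterActionLZ) (hsec : 𝔉.SgpCapSection) (hcs : 𝔉.SgpCupSection) (h8 : 𝔉.ConstantsEqNormalizer)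
        (DK : Set (TopOut 𝔉.EPiN)) (T : ThetaEnvData.{0} 𝔉.N) (ι : 𝔉.PiX ≃ₜ* T.PiX),
        𝔉.EnvIsoBiTheta h1 h3 hsec hcs h8 DK T ι :=
  fun h => not_envIsoBiTheta_datum_swap ∅ (h datum _ _ _ _ _ ∅ thetaEnvData swapTop)

end Sec5Toy

end Literature.AnabelianGeometry.EtaleTheta
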